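import Literature.NumberTheory.EllipticCurves.TwoAdicImageSurjectivityModTwoProofs
import Literature.NumberTheory.EllipticCurves.ComplexMultiplicationTwistIsogenyProofs
import Literature.NumberTheory.EllipticCurves.IsogenyHasCMIffJMemProofs
import Literature.NumberTheory.EllipticCurves.Rank1Residual.Predicates
import HarnessLib

/-!
# The habitat H₂ of route CMKolyvaginAtInertTwo in `j`-coordinates: `2` inert in the CM field and `ρ̄_{E,2}` onto
# pin `j(E)` to SEVEN values (crux `CMKolyvaginConjectureAtInertTwo`, stmt-BirchSwinnertonDyer-24648)

Seat `leafhand-bsd-cmkolyvaginatinert-3` g0 (cell `pub/bsd-eis`); helper (`--supports stmt-BirchSwinnertonDyer-24648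
--as helper`). THEOREM-ONLY file (no definition, no named fact, no `sorry`); closes nothing.

The crux's outer binders are `W.HasCM → CMInert W 2 → W.HasSurjectiveModNGaloisRep 2 → …`. In the tree's vocabulary
`CMInert W 2` reads the CM field discriminant off `j(W)` (`cmFieldDiscrOfJ`, junk `0` off the thirteen CM values): this file
records exactly which curves the universal quantifier `∀ W` ranges over.

* §1 `j_mem_of_cmInert_two` — `CMInert W 2` (neither `2 ∣ d_F` nor `d_F ≡ 1 (mod 8)`) ⟺-side: `j(W)` is one of the EIGHT
  values with `d_F ∈ {−3, −11, −19, −43, −67, −163}`: `0, 54000, −12288000` (orders of discriminant `−3, −12, −27`),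
  `−32768, −884736, −884736000, −147197952000, −262537412640768000`; hence `hasCM_of_cmInert_two`: the binder `W.HasCM` is
  implied by `CMInert W 2` (Silverman App. C §11, tree theorem `hasCM_iff_j_mem_holds`).
* §2 `exists_two_torsion_of_j_eq_54000` — EVERY elliptic curve over `ℚ` with `j = 54000` (CM by `ℤ[√−3]`) has a rational
  point of order `2`: `j = 54000 = 2⁴3³5³` forces `125 c₆² = 121 c₄³`, so `c₄ = 5t²`, `c₆ = 11t³` with `t = 5c₆/(11c₄)`, and
  `x' = −6t` is a root of `x'³ − 27c₄x' − 54c₆` (`−216 + 810 − 594 = 0`), i.e. `x = (−6t − 3b₂)/36` is a root of the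
  `2`-division polynomial `4x³ + b₂x² + 2b₄x + b₆`; hence `j_ne_54000_of_hasSurjectiveModNGaloisRep_two` by
  Dokchitser–Dokchitser (1) (tree theorem `hasSurjectiveModNGaloisRep_two_iff`).
* §3 `j_mem_of_cmInert_two_of_hasSurjectiveModNGaloisRep_two` — on H₂, **`j(W) ∈ {0, −12288000, −32768, −884736,
  −884736000, −147197952000, −262537412640768000}`**: the universal quantifier of crux 24648 (and of every H₂ statement of
  the route) ranges over the sextic twists `y² = x³ + k` and their `3`-isogenous partners (`j ∈ {0, −12288000}`) and the
  quadratic-twist families of the five odd inert CM fields — the latter carry `c_q = 2` at the CM prime (route text, rev 1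
  census) and are removed by the binder `Odd W.tamagawaProduct` IN SUBSTANCE (not proved here).

HONEST FRAMING: elementary (`c₄, c₆` algebra + two tree theorems); no stub or item is closed; BSD is proved for no curve;
beyond-print theorem: no.

References: [cite: SilvermanAEC2009, III.1 (b₂, b₄, b₆, c₄, c₆, Δ, j), Appendix C §11] [cite: SilvermanATAEC1994, App. A §3]
[cite: DokchitserDokchitserMathZ2012, Theorem (1)] [cite: Cox2013, §5.B Prop. 5.16 (splitting of 2 by d mod 8)].
-/

set_option autoImplicit false
set_option linter.dupNamespace false

noncomputable section

open scoped Classical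

namespace Summit.BirchSwinnertonDyer.BirchSwinnertonDyer.Theorems.CMKolyvaginHabitatJ

open WeierstrassCurve
open Literature.NumberTheory.EllipticCurves
open Literature.NumberTheory.EllipticCurves.Rank1Residual

variable (W : WeierstrassCurve ℚ) [W.IsElliptic]

/-! ### §1 `CMInert W 2` pins `j(W)` to eight values and implies CM -/

/-- **`2` inert in the CM field pins `j`.** If `CMInert W 2` (the tree's predicate: `2 ∤ d_F` and `d_F ≢ 1 (mod 8)`,
`d_F = cmFieldDiscrOfJ j(W)` with junk value `0` off the CM list) then
`j(W) ∈ {0, 54000, −12288000, −32768, −884736, −884736000, −147197952000, −262537412640768000}` — the `j`-invariants with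
`d_F ∈ {−3, −11, −19, −43, −67, −163}` (`−4, −8, 0` are even; `−7 ≡ 1 (mod 8)` is split).
[cite: SilvermanATAEC1994, App. A §3] [cite: Cox2013, §5.B Prop. 5.16] -/
theorem j_mem_of_cmInert_two (hin : CMInert W 2) :
    W.j ∈ ({0, 54000, -12288000, -32768, -884736, -884736000, -147197952000, -262537412640768000} : Finset ℚ) := by
  obtain ⟨hram, hsplit⟩ := hin
  simp only [CMRamified, Nat.cast_ofNat] at hram
  simp only [CMSplit, Nat.cast_ofNat, if_true, not_and] at hsplit
  have h8 : ¬ cmFieldDiscrOfJ W.j % 8 = 1 := hsplit hram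
  simp only [Finset.mem_insert, Finset.mem_singleton]
  unfold cmFieldDiscrOfJ at hram h8
  split_ifs at hram h8 with h1 h2 h3 h4 h5 h6 h7 h8' h9
  · rcases h1 with h | h | h
    · exact Or.inl h
    · exact Or.inr (Or.inl h)
    · exact Or.inr (Or.inr (Or.inl h))
  · exact absurd (by norm_num) hram
  · exact absurd (by norm_num) h8
  · exact absurd (by norm_num) hram
  · exact Or.inr (Or.inr (Or.inr (Or.inl h5)))
  · exact Or.inr (Or.inr (Or.inr (Or.inr (Or.inl h6))))
  · exact Or.inr (Or.inr (Or.inr (Or.inr (Or.inr (Or.inl h7)))))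
  · exact Or.inr (Or.inr (Or.inr (Or.inr (Or.inr (Or.inr (Or.inl h8'))))))
  · exact Or.inr (Or.inr (Or.inr (Or.inr (Or.inr (Or.inr (Or.inr h9))))))
  · exact absurd (by norm_num) hram

/-- **The binder `W.HasCM` of the crux is implied by `CMInert W 2`**: the eight `j`-values are CM `j`-invariants
(Silverman App. C §11; tree theorem `hasCM_iff_j_mem_holds`). [cite: SilvermanAEC2009, Appendix C §11] -/
theorem hasCM_of_cmInert_two (hin : CMInert W 2) : W.HasCM := by
  rw [WeierstrassCurve.hasCM_iff_j_mem_holds W]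
  have hj := j_mem_of_cmInert_two W hin
  simp only [Finset.mem_insert, Finset.mem_singleton] at hj
  simp only [cmJInvariants, Finset.mem_insert, Finset.mem_singleton]
  rcases hj with h | h | h | h | h | h | h | h <;> rw [h] <;> norm_num

/-! ### §2 `j = 54000` forces a rational point of order `2` -/

/-- **Every elliptic curve over `ℚ` with `j = 54000` has a rational point of order `2`.** From `j = c₄³/Δ = 54000` and
`1728Δ = c₄³ − c₆²`: `125c₆² = 121c₄³`, so with `t = 5c₆/(11c₄)` one has `c₄ = 5t²`, `c₆ = 11t³`, and `x = (−6t − 3b₂)/36`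
is a root of `4x³ + b₂x² + 2b₄x + b₆` (as `(36x + 3b₂)³ − 27c₄(36x + 3b₂) − 54c₆ = (−216 + 810 − 594)t³ = 0`); the point
`(x, −(a₁x + a₃)/2)` is its own negative. [cite: SilvermanAEC2009, III.1 and III.2.3] -/
theorem exists_two_torsion_of_j_eq_54000 (hj : W.j = 54000) :
    ∃ T : W.toAffine.Point, T ≠ 0 ∧ 2 • T = 0 := by
  have hΔ : W.Δ ≠ 0 := W.isUnit_Δ.ne_zero
  rw [j_eq_c₄_pow_div, div_eq_iff hΔ] at hj
  have hc4 : W.c₄ ≠ 0 := by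
    intro h0
    rw [h0] at hj
    have : W.Δ = 0 := by linear_combination (-1 / 54000 : ℚ) * hj
    exact hΔ this
  have hrel : 125 * W.c₆ ^ 2 = 121 * W.c₄ ^ 3 := by
    linear_combination (125 : ℚ) * W.c_relation + (4 : ℚ) * hj
  -- the parameter `t`
  set t : ℚ := 5 * W.c₆ / (11 * W.c₄) with ht_def
  have ht4 : W.c₄ = 5 * t ^ 2 := by
    have h : 5 * t ^ 2 * (121 * W.c₄ ^ 2) = 125 * W.c₆ ^ 2 := by
      rw [ht_def]
      field_simp
      ring
    rw [hrel] at h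
    have h' : (5 * t ^ 2 - W.c₄) * (121 * W.c₄ ^ 2) = 0 := by linear_combination h
    rcases mul_eq_zero.mp h' with h'' | h''
    · linear_combination -h''
    · exact absurd (by simpa using h'') hc4
  have ht6 : W.c₆ = 11 * t ^ 3 := by
    have h : 11 * t ^ 3 = 11 * t * t ^ 2 := by ring
    have ht2 : t ^ 2 = W.c₄ / 5 := by rw [ht4]; ring
    rw [h, ht2, ht_def]
    field_simp
  -- the `2`-torsion point
  have hEq : W.toAffine.Equation ((-6 * t - 3 * W.b₂) / 36) (-(W.a₁ * ((-6 * t - 3 * W.b₂) / 36) + W.a₃) / 2) := by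
    rw [WeierstrassCurve.Affine.equation_iff]
    simp only [WeierstrassCurve.c₄, WeierstrassCurve.c₆, WeierstrassCurve.b₂, WeierstrassCurve.b₄,
      WeierstrassCurve.b₆] at ht4 ht6 ⊢
    linear_combination (-t / 288) * ht4 + (1 / 864 : ℚ) * ht6
  have hns : W.toAffine.Nonsingular ((-6 * t - 3 * W.b₂) / 36) (-(W.a₁ * ((-6 * t - 3 * W.b₂) / 36) + W.a₃) / 2) :=
    WeierstrassCurve.Affine.equation_iff_nonsingular.mp hEq
  refine ⟨WeierstrassCurve.Affine.Point.some _ _ hns, WeierstrassCurve.Affine.Point.some_ne_zero hns, ?_⟩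
  have hneg : -(WeierstrassCurve.Affine.Point.some _ _ hns : W.toAffine.Point) =
      WeierstrassCurve.Affine.Point.some _ _ hns := by
    rw [WeierstrassCurve.Affine.Point.neg_some]
    congr 1
    rw [WeierstrassCurve.Affine.negY]
    ring
  rw [two_nsmul]
  exact neg_eq_iff_add_eq_zero.mp hneg

/-- **On the habitat, `j ≠ 54000`**: a surjective `ρ̄_{E,2}` admits no rational point of order `2` (Dokchitser–Dokchitser
(1), tree theorem `hasSurjectiveModNGaloisRep_two_iff`). [cite: DokchitserDokchitserMathZ2012, Theorem (1)] -/
theorem j_ne_54000_of_hasSurjectiveModNGaloisRep_two (hs : W.HasSurjectiveModNGaloisRep 2) : W.j ≠ 54000 := by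
  intro hj
  obtain ⟨T, hT0, h2T⟩ := exists_two_torsion_of_j_eq_54000 W hj
  exact hT0 (((hasSurjectiveModNGaloisRep_two_iff W).mp hs).1 T h2T)

/-! ### §3 H₂ in `j`-coordinates -/

/-- **The `j`-invariants of H₂.** For `W/ℚ` elliptic with `2` inert in the CM field (`CMInert W 2`) and `ρ̄_{E,2}` onto:
`j(W) ∈ {0, −12288000, −32768, −884736, −884736000, −147197952000, −262537412640768000}` — so the universal quantifier of
crux 24648 ranges over the `j = 0` sextic twists `y² = x³ + k`, their `3`-isogenous `j = −12288000` partners, and the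
quadratic-twist families of the five odd inert CM fields `d_F ∈ {−11, −19, −43, −67, −163}`.
[cite: SilvermanATAEC1994, App. A §3] [cite: DokchitserDokchitserMathZ2012, Theorem (1)] -/
theorem j_mem_of_cmInert_two_of_hasSurjectiveModNGaloisRep_two (hin : CMInert W 2)
    (hs : W.HasSurjectiveModNGaloisRep 2) :
    W.j ∈ ({0, -12288000, -32768, -884736, -884736000, -147197952000, -262537412640768000} : Finset ℚ) := by
  have hj := j_mem_of_cmInert_two W hin
  have h54 := j_ne_54000_of_hasSurjectiveModNGaloisRep_two W hs
  simp only [Finset.mem_insert, Finset.mem_singleton] at hj ⊢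
  rcases hj with h | h | h | h | h | h | h | h
  · exact Or.inl h
  · exact absurd h h54
  · exact Or.inr (Or.inl h)
  · exact Or.inr (Or.inr (Or.inl h))
  · exact Or.inr (Or.inr (Or.inr (Or.inl h)))
  · exact Or.inr (Or.inr (Or.inr (Or.inr (Or.inl h))))
  · exact Or.inr (Or.inr (Or.inr (Or.inr (Or.inr (Or.inl h)))))
  · exact Or.inr (Or.inr (Or.inr (Or.inr (Or.inr (Or.inr h)))))

/-- **The CM field on H₂ is one of six**: `d_F ∈ {−3, −11, −19, −43, −67, −163}` (all `≡ 5 (mod 8)`: `2` inert).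
[cite: Cox2013, §5.B Prop. 5.16] [cite: SilvermanATAEC1994, App. A §3] -/
theorem cmFieldDiscrOfJ_mem_of_cmInert_two (hin : CMInert W 2) :
    cmFieldDiscrOfJ W.j ∈ ({-3, -11, -19, -43, -67, -163} : Finset ℤ) := by
  have hj := j_mem_of_cmInert_two W hin
  simp only [Finset.mem_insert, Finset.mem_singleton] at hj ⊢
  rcases hj with h | h | h | h | h | h | h | h <;> rw [h] <;> norm_num [cmFieldDiscrOfJ]

end Summit.BirchSwinnertonDyer.BirchSwinnertonDyer.Theorems.CMKolyvaginHabitatJ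

end
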